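import Literature.IUT.HodgeTheaters.PuncturedEllipticArrowModelDatum
import HarnessLib

/-!
# [IUTchI] §1 — the `ι`-law `hι'` of Cor. 1.2's resp'd clause (and the bridge inputs `hIH`, `hXH`) HOLD at
# the finite §1 model (NV witness)

Mochizuki, *Inter-universal Teichmüller theory I*, kurims manuscript (May 2020), §1 pp. 37–39
([IUTchI] §1 p.38) [claim: Mochizuki2012, status: disputed] — WITNESS-class module (pure finite group
theory over abc-iut-L5-t1's model `ArrowModel.datum`, p431223); nothing of the series is asserted; no side
is taken on [IUTchIII] Cor. 3.12.  Node `IUTchI:Cor1.2` (abc-iut-L5-d4); proof-only, no definitions.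

WHAT.  The closer of record `InitialThetaData.pe_characteristicNatureOfCoverings_viaX` (p447384) binds ONE
classical law `hι'`: "an element of `Δ_C̲ ∖ Δ_X̲` does not centralise `Δ_X` modulo
`H = Ker(Δ_X ↠ Δ_X^{ab} ⊗ ℤ/lℤ)`" (print p. 38 l. 1: "`ι` acts on `Δ_E ⊗ (ℤ/lℤ)` via multiplication by
`−1`").  NON-VACUITY: the law HOLDS at the finite §1 model `Π_C = N ⋊ D_l` of abc-iut-L5-t1 (where ALL typed
§1 predicates hold: `ArrowCoveringClaims`, `Rmk121`, `CuspGalois`, `ArrowOpenClaims`, the Def. 3.1 (d)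
numerics — p431223), so the new binder is jointly satisfiable with the frozen §1 record:
`ArrowModel.iotaLaw_datum`; and so do the two inputs of the bridge `…Cor12IotaLawOfLaws` (p448270) —
`hIH` "every cusp inertia group lies in `H`" (`ArrowModel.inertia_le_H_datum`: `ĉ_x = (c_x, 1)` is the
commutator `[r_1, B_x]` in `Π_X`) and `hXH` "`Δ_X̲ ⊄ H`" (`ArrowModel.not_deltaXbar_le_H_datum`); packaged as
`ArrowModel.exists_datum_iotaLaw`.  MECHANISM (= print's): the `A`-coordinate (`A = a^l`, the class fixed by
the rotations `r_k` and NEGATED by the reflections `σ_k`) is additive on `Π_X = N ⋊ ⟨r⟩`, so it kills `H`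
(`ArrowModel.fst_left_eq_zero_of_mem_H`); for `c ∈ Π_C̲ ∖ N` (`c = (n, s)`) and `v = A`:
`c v c⁻¹ v⁻¹ = −2A ∉ H` (`2 ≠ 0` in `ℤ/l`, `l ≥ 5`), while `A ∈ N = Δ_X̲` has `A`-coordinate `1 ≠ 0`.
Label: [model; finite shadow, `G_k = 1`]; inhabited ≠ discharged.
-/

namespace Literature.IUT.HodgeTheaters

namespace PuncturedEllipticData

namespace ArrowModel

open DihedralGroup
open scoped Pointwise

variable {l : ℕ}

/-! ### The `A`-coordinate is additive on `Π_X = N ⋊ ⟨r⟩` -/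

/-- On `Π_X = N ⋊ ⟨r⟩` the `A`-coordinate of a product is the sum of the `A`-coordinates (rotations fix
`A`). [claim: Mochizuki2012, status: disputed] -/
theorem fst_left_mul_of_mem_PiXm {g : G l} (hg : g ∈ PiXm l) (h : G l) :
    (Multiplicative.toAdd (g * h).left).1 =
      (Multiplicative.toAdd g.left).1 + (Multiplicative.toAdd h.left).1 := by
  obtain ⟨k, hk⟩ := hg
  simp only [SemidirectProduct.mul_left, toAdd_mul, toAdd_phi_apply, hk, dact_r, rot_apply, Prod.fst_add]

/-- On `Π_X` the `A`-coordinate of an inverse is the negative. [claim: Mochizuki2012, status: disputed] -/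
theorem fst_left_inv_of_mem_PiXm {g : G l} (hg : g ∈ PiXm l) :
    (Multiplicative.toAdd g⁻¹.left).1 = -(Multiplicative.toAdd g.left).1 := by
  obtain ⟨k, hk⟩ := hg
  simp only [SemidirectProduct.inv_left, toAdd_phi_apply, hk, inv_r, dact_r, rot_apply, toAdd_inv,
    Prod.fst_neg]

/-- On `Π_X` the `A`-coordinate of an `n`-th power is `n •` the `A`-coordinate.
[claim: Mochizuki2012, status: disputed] -/
theorem fst_left_pow_of_mem_PiXm {g : G l} (hg : g ∈ PiXm l) (n : ℕ) :
    (Multiplicative.toAdd (g ^ n).left).1 = n • (Multiplicative.toAdd g.left).1 := by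
  induction n with
  | zero => simp
  | succ n ih =>
    rw [pow_succ', fst_left_mul_of_mem_PiXm hg, ih, succ_nsmul']

/-- On `Π_X` the `A`-coordinate of a commutator vanishes. [claim: Mochizuki2012, status: disputed] -/
theorem fst_left_commutator_of_mem_PiXm {g h : G l} (hg : g ∈ PiXm l) (hh : h ∈ PiXm l) :
    (Multiplicative.toAdd (g * h * g⁻¹ * h⁻¹).left).1 = 0 := by
  rw [fst_left_mul_of_mem_PiXm ((PiXm l).mul_mem ((PiXm l).mul_mem hg hh) ((PiXm l).inv_mem hg)),
    fst_left_mul_of_mem_PiXm ((PiXm l).mul_mem hg hh), fst_left_mul_of_mem_PiXm hg,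
    fst_left_inv_of_mem_PiXm hg, fst_left_inv_of_mem_PiXm hh]
  abel

/-- The inertia element `ĉ_x = (c_x, 1)` is a commutator in `Π_X = N ⋊ ⟨r⟩`: `c_x = B_{x+1} − B_x = r_1(B_x) − B_x`
(the cusps of `X̲` lie over the single cusp of `X`, whose inertia is a commutator).
[claim: Mochizuki2012, status: disputed] -/
theorem chat_mem_commutator_PiXm (x : ZMod l) : chat l x ∈ ⁅PiXm l, PiXm l⁆ := by
  have hg : (SemidirectProduct.inr (r 1) : G l) ∈ PiXm l := ⟨1, SemidirectProduct.right_inr _⟩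
  have hv : inN l ((0 : ZMod l), δ l x) ∈ PiXm l := ⟨0, by rw [inN_right, r_zero]⟩
  have key : SemidirectProduct.inr (r 1) * inN l ((0 : ZMod l), δ l x) * (SemidirectProduct.inr (r 1))⁻¹ *
      (inN l ((0 : ZMod l), δ l x))⁻¹ = chat l x := by
    rw [conj_inN, SemidirectProduct.right_inr, dact_r, ← inN_neg, ← inN_add]
    unfold chat cvec
    congr 1
    ext m
    · simp
    · simp only [rot_apply, Prod.snd_add, Prod.snd_neg, Pi.add_apply, Pi.neg_apply, Pi.sub_apply, δ_apply,
        sub_eq_iff_eq_add]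
      ring
  rw [← key]
  exact Subgroup.commutator_mem_commutator hg hv

/-! ### `H = Ker(Δ_X ↠ Δ_X^{ab} ⊗ ℤ/lℤ)` at the datum lies in `{A = 0}` -/

/-- At the finite §1 model, every element of `H = Ker(Δ_X ↠ Δ_X^{ab} ⊗ ℤ/lℤ)` (`Δ_X = Π_X = N ⋊ ⟨r⟩` as
`G_k = 1`) lies in `Π_X` and has `A`-coordinate `0` (the `A`-coordinate is additive on `Π_X`, so it kills
commutators and `l`-th powers; the topology is discrete). [claim: Mochizuki2012, status: disputed] -/
theorem fst_left_eq_zero_of_mem_H (h5 : 5 ≤ l) (h6 : Nat.Coprime l 6) {g : G l}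
    (hg : g ∈ (⁅(datum l h5 h6).PiX ⊓ (datum l h5 h6).DeltaC, (datum l h5 h6).PiX ⊓ (datum l h5 h6).DeltaC⁆ ⊔
      Subgroup.closure ((fun y : (datum l h5 h6).PiC => y ^ (datum l h5 h6).l) ''
        ((datum l h5 h6).PiX ⊓ (datum l h5 h6).DeltaC : Set (datum l h5 h6).PiC))).topologicalClosure) :
    g ∈ PiXm l ∧ (Multiplicative.toAdd g.left).1 = 0 := by
  haveI : NeZero l := ⟨by omega⟩
  haveI : DiscreteTopology (datum l h5 h6).PiC := discreteTopology_arithGrp l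
  -- `Δ_X = Π_X = N ⋊ ⟨r⟩`
  have hΔX : (datum l h5 h6).PiX ⊓ (datum l h5 h6).DeltaC = PiXm l := by
    rw [deltaC_eq_top, inf_top_eq]
  -- the subgroup of `Π_X` cut out by the `A`-coordinate (all algebra in `G l = N ⋊ D_l`)
  let M : Subgroup (G l) :=
    { carrier := {g | g ∈ PiXm l ∧ (Multiplicative.toAdd g.left).1 = 0}
      mul_mem' := by
        rintro g h ⟨hg, hg0⟩ ⟨hh, hh0⟩
        exact ⟨(PiXm l).mul_mem hg hh, by rw [fst_left_mul_of_mem_PiXm hg, hg0, hh0, add_zero]⟩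
      one_mem' := ⟨(PiXm l).one_mem, by simp⟩
      inv_mem' := by
        rintro g ⟨hg, hg0⟩
        exact ⟨(PiXm l).inv_mem hg, by rw [fst_left_inv_of_mem_PiXm hg, hg0, neg_zero]⟩ }
  have hM : ∀ g : G l, g ∈ M ↔ g ∈ PiXm l ∧ (Multiplicative.toAdd g.left).1 = 0 := fun g => Iff.rfl
  -- `H ≤ M`
  have hHM : (⁅(datum l h5 h6).PiX ⊓ (datum l h5 h6).DeltaC, (datum l h5 h6).PiX ⊓ (datum l h5 h6).DeltaC⁆ ⊔
      Subgroup.closure ((fun y : (datum l h5 h6).PiC => y ^ (datum l h5 h6).l) ''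
        ((datum l h5 h6).PiX ⊓ (datum l h5 h6).DeltaC : Set (datum l h5 h6).PiC))).topologicalClosure ≤
      (M : Subgroup (datum l h5 h6).PiC) := by
    refine Subgroup.topologicalClosure_minimal _ (sup_le ?_ ?_) (isClosed_discrete _)
    · rw [Subgroup.commutator_le]
      intro g hg h hh
      rw [hΔX] at hg hh
      exact (hM (g * h * g⁻¹ * h⁻¹)).mpr
        ⟨(PiXm l).mul_mem ((PiXm l).mul_mem ((PiXm l).mul_mem hg hh) ((PiXm l).inv_mem hg))
          ((PiXm l).inv_mem hh), fst_left_commutator_of_mem_PiXm hg hh⟩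
    · rw [Subgroup.closure_le]
      rintro _ ⟨y, hy, rfl⟩
      have hy' : y ∈ PiXm l := by rw [← hΔX]; exact hy
      have hpow := fst_left_pow_of_mem_PiXm hy' l
      rw [nsmul_eq_mul, ZMod.natCast_self, zero_mul] at hpow
      exact (hM ((y : G l) ^ l)).mpr ⟨(PiXm l).pow_mem hy' l, hpow⟩
  exact (hM g).mp (hHM hg)

/-! ### The laws at the datum -/

/-- **NV: every cusp inertia group lies in `H`** at the finite §1 model (`I_x = ⟨ĉ_x⟩`, `ĉ_x` a commutator in
`Π_X`) — the input `hIH` of `…Cor12IotaLawOfLaws` (p448270) holds there.  Inhabited ≠ discharged.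
([IUTchI] §1 p.37) [claim: Mochizuki2012, status: disputed] -/
theorem inertia_le_H_datum (h5 : 5 ≤ l) (h6 : Nat.Coprime l 6) (x : (datum l h5 h6).Cusp) :
    (datum l h5 h6).inertia x ≤
      (⁅(datum l h5 h6).PiX ⊓ (datum l h5 h6).DeltaC, (datum l h5 h6).PiX ⊓ (datum l h5 h6).DeltaC⁆ ⊔
        Subgroup.closure ((fun y : (datum l h5 h6).PiC => y ^ (datum l h5 h6).l) ''
          ((datum l h5 h6).PiX ⊓ (datum l h5 h6).DeltaC : Set (datum l h5 h6).PiC))).topologicalClosure := by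
  haveI : NeZero l := ⟨by omega⟩
  have hΔX : (datum l h5 h6).PiX ⊓ (datum l h5 h6).DeltaC = PiXm l := by
    rw [deltaC_eq_top, inf_top_eq]
  rw [inertia_eq]
  intro g hg
  unfold Dm at hg
  obtain ⟨k, rfl⟩ := Subgroup.mem_zpowers_iff.mp hg
  let c' : (datum l h5 h6).PiC := chat l x
  have hchat : c' ∈
      (⁅(datum l h5 h6).PiX ⊓ (datum l h5 h6).DeltaC, (datum l h5 h6).PiX ⊓ (datum l h5 h6).DeltaC⁆ ⊔
        Subgroup.closure ((fun y : (datum l h5 h6).PiC => y ^ (datum l h5 h6).l) ''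
          ((datum l h5 h6).PiX ⊓ (datum l h5 h6).DeltaC : Set (datum l h5 h6).PiC))).topologicalClosure := by
    refine Subgroup.le_topologicalClosure _ (Subgroup.mem_sup_left ?_)
    rw [hΔX]
    exact chat_mem_commutator_PiXm x
  exact Subgroup.zpow_mem _ hchat k

/-- **NV: `Δ_X̲ ⊄ H`** at the finite §1 model (`A ∈ N = Δ_X̲` has `A`-coordinate `1 ≠ 0`) — the input `hXH`
of `…Cor12IotaLawOfLaws` (p448270) holds there.  Inhabited ≠ discharged.
([IUTchI] §1 p.37) [claim: Mochizuki2012, status: disputed] -/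
theorem not_deltaXbar_le_H_datum (h5 : 5 ≤ l) (h6 : Nat.Coprime l 6) :
    ¬ (datum l h5 h6).DeltaXbar ≤
      (⁅(datum l h5 h6).PiX ⊓ (datum l h5 h6).DeltaC, (datum l h5 h6).PiX ⊓ (datum l h5 h6).DeltaC⁆ ⊔
        Subgroup.closure ((fun y : (datum l h5 h6).PiC => y ^ (datum l h5 h6).l) ''
          ((datum l h5 h6).PiX ⊓ (datum l h5 h6).DeltaC : Set (datum l h5 h6).PiC))).topologicalClosure := by
  haveI : NeZero l := ⟨by omega⟩
  intro hle
  have hmem : inN l ((1 : ZMod l), 0) ∈ (datum l h5 h6).DeltaXbar := by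
    rw [deltaXbar_eq]
    exact inN_mem_Nhat l _
  have h0 := (fst_left_eq_zero_of_mem_H h5 h6 (hle hmem)).2
  rw [inN_left, toAdd_ofAdd] at h0
  exact (cusp_facts_of_five_le l h5).1 h0

/-- **NV witness: the `ι`-law `hι'` of [IUTchI] Cor. 1.2's resp'd clause (p447384) HOLDS at abc-iut-L5-t1's
finite §1 model `ArrowModel.datum`** [model; finite shadow, `G_k = 1`]: for `c ∈ Δ_C̲ ∖ Δ_X̲` the element
`v := A ∈ Δ_X` has `c v c⁻¹ v⁻¹ = −2A ∉ H = Ker(Δ_X ↠ Δ_X^{ab} ⊗ ℤ/lℤ)` — the `A`-coordinate kills `H` but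
`2 ≠ 0` in `ℤ/l`.  Inhabited ≠ discharged. ([IUTchI] §1 p.38) [claim: Mochizuki2012, status: disputed] -/
theorem iotaLaw_datum (h5 : 5 ≤ l) (h6 : Nat.Coprime l 6) :
    ∀ c ∈ (datum l h5 h6).DeltaCbar, c ∉ (datum l h5 h6).DeltaXbar →
      ∃ v ∈ (datum l h5 h6).PiX ⊓ (datum l h5 h6).DeltaC,
        c * v * c⁻¹ * v⁻¹ ∉ (⁅(datum l h5 h6).PiX ⊓ (datum l h5 h6).DeltaC,
            (datum l h5 h6).PiX ⊓ (datum l h5 h6).DeltaC⁆ ⊔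
          Subgroup.closure ((fun y : (datum l h5 h6).PiC => y ^ (datum l h5 h6).l) ''
            ((datum l h5 h6).PiX ⊓ (datum l h5 h6).DeltaC : Set (datum l h5 h6).PiC))).topologicalClosure := by
  haveI : NeZero l := ⟨by omega⟩
  intro c hc hcX
  change G l at c
  rw [deltaCbar_eq] at hc
  rw [deltaXbar_eq] at hcX
  -- `c = (n, s)`
  have hcr : c.right = sr 0 := by
    rcases (mem_PiCbarm_iff l c).mp hc with h1 | h1
    · exact absurd ((mem_Nhat_iff l c).mpr h1) hcX
    · exact h1
  have hΔX : (datum l h5 h6).PiX ⊓ (datum l h5 h6).DeltaC = PiXm l := by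
    rw [deltaC_eq_top, inf_top_eq]
  -- the witness `v := A`
  refine ⟨inN l ((1 : ZMod l), 0), ?_, fun hmem => ?_⟩
  · rw [hΔX]
    exact ⟨0, by rw [inN_right, r_zero]⟩
  have hA : (Multiplicative.toAdd
      (c * inN l ((1 : ZMod l), 0) * c⁻¹ * (inN l ((1 : ZMod l), 0))⁻¹).left).1 = 0 :=
    (fst_left_eq_zero_of_mem_H h5 h6 hmem).2
  -- the `A`-coordinate of `c v c⁻¹ v⁻¹` is `−2`
  have hcalc : (Multiplicative.toAdd
      (c * inN l ((1 : ZMod l), 0) * c⁻¹ * (inN l ((1 : ZMod l), 0))⁻¹).left).1 = -2 := by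
    simp only [SemidirectProduct.mul_left, SemidirectProduct.mul_right, SemidirectProduct.inv_left,
      SemidirectProduct.inv_right, toAdd_mul, toAdd_inv, toAdd_phi_apply, hcr, inN_left, inN_right,
      toAdd_ofAdd, mul_one, inv_sr, sr_mul_sr, sub_self, r_zero, dact_sr, refl_apply,
      Prod.fst_add, Prod.fst_neg, Prod.neg_mk, neg_neg, map_one, MulAut.one_apply, inv_one, sub_zero]
    ring
  rw [hcalc] at hA
  exact (cusp_facts_of_five_le l h5).2.2.2.1 (neg_eq_zero.mp hA)

/-- Packaged: the finite §1 model carries a datum at which ALL the typed §1 predicates hold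
(`ArrowCoveringClaims`, `Rmk121`, a cusp action `CuspGalois`) TOGETHER WITH the `ι`-law `hι'` of p447384 and
the two inputs `hIH` (cusp inertia in `H`), `hXH` (`Δ_X̲ ⊄ H`) of the bridge p448270 — the new Cor. 1.2
binders are jointly satisfiable with the frozen §1 record.  Inhabited ≠ discharged.
([IUTchI] §1 p.38) [claim: Mochizuki2012, status: disputed] -/
theorem exists_datum_iotaLaw (h5 : 5 ≤ l) (h6 : Nat.Coprime l 6) :
    ∃ D : PuncturedEllipticData.{0}, D.ArrowCoveringClaims ∧ D.Rmk121 ∧ Nonempty D.CuspGalois ∧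
      (∀ c ∈ D.DeltaCbar, c ∉ D.DeltaXbar → ∃ v ∈ D.PiX ⊓ D.DeltaC,
        c * v * c⁻¹ * v⁻¹ ∉ (⁅D.PiX ⊓ D.DeltaC, D.PiX ⊓ D.DeltaC⁆ ⊔
          Subgroup.closure ((fun y : D.PiC => y ^ D.l) '' (D.PiX ⊓ D.DeltaC : Set D.PiC))).topologicalClosure) ∧
      (∀ x : D.Cusp, D.inertia x ≤ (⁅D.PiX ⊓ D.DeltaC, D.PiX ⊓ D.DeltaC⁆ ⊔
          Subgroup.closure ((fun y : D.PiC => y ^ D.l) '' (D.PiX ⊓ D.DeltaC : Set D.PiC))).topologicalClosure) ∧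
      ¬ D.DeltaXbar ≤ (⁅D.PiX ⊓ D.DeltaC, D.PiX ⊓ D.DeltaC⁆ ⊔
          Subgroup.closure ((fun y : D.PiC => y ^ D.l) '' (D.PiX ⊓ D.DeltaC : Set D.PiC))).topologicalClosure :=
  ⟨datum l h5 h6, arrowCoveringClaims h5 h6, rmk121 h5 h6, ⟨cuspGalois h5 h6⟩, iotaLaw_datum h5 h6,
    inertia_le_H_datum h5 h6, not_deltaXbar_le_H_datum h5 h6⟩

end ArrowModel

end PuncturedEllipticData

end Literature.IUT.HodgeTheaters
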